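import Mathlib
import HarnessLib
import Literature.Analysis.FluidPDE.TypeIAncientMild
import Summits.NavierStokesRegularity.NavierStokesRegularity.Theorems.SqueezeCycleExtremalElementExistsExtraction
import Summits.NavierStokesRegularity.NavierStokesRegularity.Theorems.SymmetryModuliCountFarPastLedgerReduction
import Summits.NavierStokesRegularity.NavierStokesRegularity.Theorems.PoloidalWindowDoorPoloidalWindowRigidityPoloidalExtremal

/-!
# AxisTwistDoor · crux `TiltDominationLoc` (stmt-NavierStokesRegularity-26991), line «signcone» — THE FAMILY OF APEX-ZOOM
# LIMITS OF ONE PROFILE, and a SIGN-SATURATED element in it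

Helper file (`--supports stmt-NavierStokesRegularity-26991 --as helper`; seat ns-imp-p1 g5, DIRECTOR-NS #244 (4); line author
ns-idea-6 g7, LEAD of record ns-atd-p1).  No definitions.  Fix a profile `v` of the KNSS Type-I ancient mild class
`A_C = IsTypeIAncientMild C` and consider the family

  `X(v) = { W ∈ A_C : W(t,x) = lim_n λ_n v(λ_n² t, λ_n x) pointwise on the open backward slab, for some λ_n → 0⁺ }`

of pointwise limits of APEX ZOOMS OF `v` ITSELF (`nsRescale`).  The global SIGN CONE of a profile `W` is the closed convex cone
`{e : ⟪curl W(s) y, e⟫ ≥ 0 for all s < 0, y}`; its LOCAL sign cone is `{e : the same on SOME apex cylinder (−ρ², 0) × B(0, ρ)}`.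

* `exists_upperBound_stable` — the order-theoretic engine (pure): for a transitive relation `R` with successors, in which every
  `R`-chain `x₀ R x₁ R x₂ …` has an `R`-upper bound, and a monotone `N : X → Set ℕ`, some `R`-upper bound `W` of a chain from
  `x₀` has `N y = N W` for EVERY `R`-successor `y` of `W` (a greedy diagonal chain capturing each index it can; a countable
  substitute for a minimal zoom-invariant set / Zorn).
* `exists_zoomSeq_of_tendsto` — CLOSEDNESS OF `X(v)`: a pointwise limit in `A_C` of elements of `X(v)` is again in `X(v)`,
  with convergence of the GRADIENTS of the zooms thrown in (diagonal choice of scales along a dense sequence of the open slab,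
  KNSS `C¹_loc` re-extraction `exists_tendsto_of_isTypeIAncientMild_seq`, identification of the two limits by continuity).
* `exists_zoomIn_successor` — every `W ∈ X(v)` has a ZOOM-IN LIMIT `W' ∈ X(v)` whose global sign cone contains the LOCAL
  sign cone of `W` (a direction one-signed on an apex cylinder of `W` is one-signed everywhere on every zoom-in limit).
* `exists_saturated_zoomLimit` — **there is `W ∈ X(v)` which is SIGN-SATURATED** (local sign cone = global sign cone) and
  whose sign cone contains that of `v`: the engine applied to `R W W' :⇔ loc-cone(W) ⊆ cone(W')` and
  `N W = {i : Bᵢ meets cone(W)}` for a countable basis `(Bᵢ)` of `ℝ³` (on CLOSED cones `N` is injective along inclusions).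

Persistence of the apex singularity is NOT used here: it enters only for the output element, which is a.e. Seregin's ancient
zoom-in limit of `v` along the same scales (`…AxisTwistDoorSignConeZoomSingular`).  HONEST FRAMING: compactness / normal-form
lemmas about HYPOTHETICAL Type-I ancient profiles; nothing here bears on Navier–Stokes regularity (Clay A OPEN), on the crux
26991 or on the wall `StubRayRigidity`.
-/

noncomputable section

-- the summit and its single sub-problem share the name (CONVENTIONS §1), as in every Theorems file
set_option linter.dupNamespace false

namespace Summit.NavierStokesRegularity.NavierStokesRegularity.Theorems.AxisTwistDoorSignConeZoomFamily

open MeasureTheory Set Function Filter Topology TopologicalSpace Metric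
open scoped RealInnerProductSpace InnerProductSpace
open Literature.Analysis Literature.Analysis.FluidPDE
open Summit.NavierStokesRegularity.NavierStokesRegularity.Theorems
open Summit.NavierStokesRegularity.NavierStokesRegularity.Theorems.PoloidalWindowDoorPoloidalWindowRigidityPoloidalExtremal

/-! ### §0 The order-theoretic engine -/

/-- **Greedy stabilisation along chains.**  Let `R` be transitive with successors (`∀ x, ∃ y, R x y`), suppose every `R`-chain
`x 0 R x 1 R x 2 R …` has an `R`-upper bound, and let `N : X → Set ℕ` be monotone along `R`.  Then for every `x₀` there is `W`
with `R x₀ W` such that `N y ⊆ N W` for every `y` with `R W y` (so `N` is constant on the `R`-successors of `W`).  Proof: the chain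
whose `n`-th step captures the index `(Nat.unpair n).1` into `N` whenever some `R`-successor allows it; any upper bound works,
because every index is revisited at a later stage below every successor of the bound. [folklore] -/
theorem exists_upperBound_stable {X : Type*} (R : X → X → Prop) (N : X → Set ℕ)
    (htrans : ∀ ⦃x y z : X⦄, R x y → R y z → R x z) (hsucc : ∀ x, ∃ y, R x y)
    (hchain : ∀ x : ℕ → X, (∀ n, R (x n) (x (n + 1))) → ∃ W, ∀ n, R (x n) W)
    (hmono : ∀ ⦃x y : X⦄, R x y → N x ⊆ N y) (x₀ : X) :
    ∃ W, R x₀ W ∧ ∀ y, R W y → N y ⊆ N W := by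
  classical
  -- one greedy step at stage `n` from the point `x`
  let step : ℕ → X → X := fun n x =>
    if h : ∃ y, R x y ∧ (Nat.unpair n).1 ∈ N y then h.choose else (hsucc x).choose
  have hstep : ∀ n x, R x (step n x) := by
    intro n x
    by_cases h : ∃ y, R x y ∧ (Nat.unpair n).1 ∈ N y
    · simp only [step, dif_pos h]; exact h.choose_spec.1
    · simp only [step, dif_neg h]; exact (hsucc x).choose_spec
  have hcap : ∀ n x, (∃ y, R x y ∧ (Nat.unpair n).1 ∈ N y) → (Nat.unpair n).1 ∈ N (step n x) := by
    intro n x h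
    simp only [step, dif_pos h]
    exact h.choose_spec.2
  -- the greedy chain
  let x : ℕ → X := fun n => Nat.rec x₀ (fun k xk => step k xk) n
  have hxs : ∀ n, x (n + 1) = step n (x n) := fun n => rfl
  have hxR : ∀ n, R (x n) (x (n + 1)) := fun n => by rw [hxs]; exact hstep n (x n)
  obtain ⟨W, hW⟩ := hchain x hxR
  refine ⟨W, hW 0, fun y hy i hi => ?_⟩
  -- the index `i` is processed (at least) at stage `Nat.pair i 0`, below `y`
  have hun : (Nat.unpair (Nat.pair i 0)).1 = i := by rw [Nat.unpair_pair]
  have hex : ∃ y', R (x (Nat.pair i 0)) y' ∧ (Nat.unpair (Nat.pair i 0)).1 ∈ N y' :=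
    ⟨y, htrans (hW _) hy, by rw [hun]; exact hi⟩
  have hmem := hcap _ _ hex
  rw [hun, ← hxs] at hmem
  exact hmono (hW (Nat.pair i 0 + 1)) hmem

/-- **Closed sets are separated by a basis**: if `K` is closed, `(Bᵢ)` enumerates a topological basis, and every `Bᵢ` meeting
`K'` meets `K`, then `K' ⊆ K`. [folklore] -/
theorem subset_of_isClosed_of_basis {V : Type*} [TopologicalSpace V] {B : ℕ → Set V}
    (hB : IsTopologicalBasis (range B)) {K K' : Set V} (hK : IsClosed K)
    (h : ∀ i, (B i ∩ K').Nonempty → (B i ∩ K).Nonempty) : K' ⊆ K := by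
  intro x hx
  by_contra hxK
  obtain ⟨t, ⟨i, rfl⟩, hxt, htK⟩ := hB.mem_nhds_iff.1 (hK.isOpen_compl.mem_nhds hxK)
  obtain ⟨z, hzB, hzK⟩ := h i ⟨x, hxt, hx⟩
  exact htK hzB hzK

/-! ### §1 Sign cones: closedness and passage to limits -/

/-- The global sign cone `{e : ⟪curl W(s) y, e⟫ ≥ 0 ∀ s < 0 ∀ y}` is closed. [folklore] -/
theorem isClosed_signCone (W : ℝ → EuclideanSpace ℝ (Fin 3) → EuclideanSpace ℝ (Fin 3)) :
    IsClosed {e : EuclideanSpace ℝ (Fin 3) | ∀ s < (0 : ℝ), ∀ y : EuclideanSpace ℝ (Fin 3), 0 ≤ ⟪curl (W s) y, e⟫_ℝ} := by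
  have e : {e : EuclideanSpace ℝ (Fin 3) | ∀ s < (0 : ℝ), ∀ y : EuclideanSpace ℝ (Fin 3), 0 ≤ ⟪curl (W s) y, e⟫_ℝ} =
      ⋂ s ∈ Iio (0 : ℝ), ⋂ y : EuclideanSpace ℝ (Fin 3), {e | 0 ≤ ⟪curl (W s) y, e⟫_ℝ} := by
    ext e'
    simp only [mem_setOf_eq, mem_iInter, mem_Iio]
  rw [e]
  exact isClosed_biInter fun s _ => isClosed_iInter fun y =>
    isClosed_le continuous_const (continuous_const.inner continuous_id)

/-- **Signs pass to limits of gradients**: if the gradients of `V j` at `y` converge to the gradient of `W'` and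
`⟪curl (V j) y, e⟫ ≥ 0` for all large `j`, then `⟪curl W' y, e⟫ ≥ 0`. [folklore] -/
theorem inner_curl_nonneg_of_tendsto {V : ℕ → EuclideanSpace ℝ (Fin 3) → EuclideanSpace ℝ (Fin 3)}
    {W' : EuclideanSpace ℝ (Fin 3) → EuclideanSpace ℝ (Fin 3)} {y e : EuclideanSpace ℝ (Fin 3)}
    (h : Tendsto (fun j => fderiv ℝ (V j) y) atTop (𝓝 (fderiv ℝ W' y)))
    (hev : ∀ᶠ j in atTop, 0 ≤ ⟪curl (V j) y, e⟫_ℝ) : 0 ≤ ⟪curl W' y, e⟫_ℝ :=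
  ge_of_tendsto ((tendsto_curl_of_tendsto_fderiv h).inner tendsto_const_nhds) hev

/-- The vorticity of an apex zoom tested against `e`: `⟪curl (λ v(λ²·, λ·))(s) y, e⟫ = λ² ⟪curl v(λ² s)(λ y), e⟫`. [folklore] -/
theorem inner_curl_nsRescale (c : ℝ) (u : ℝ → EuclideanSpace ℝ (Fin 3) → EuclideanSpace ℝ (Fin 3)) (s : ℝ)
    (y e : EuclideanSpace ℝ (Fin 3)) :
    ⟪curl (nsRescale c u s) y, e⟫_ℝ = c ^ 2 * ⟪curl (u (c ^ 2 * s)) (c • y), e⟫_ℝ := by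
  rw [curl_nsRescale_slice, real_inner_smul_left]

/-- A direction one-signed on the apex cylinder `(−ρ², 0) × B(0, ρ)` of `W` is one-signed at `(s, y)` for the zooms
`λ W(λ²·, λ·)` as soon as `λ` is small (`λ → 0⁺` along the sequence). [folklore] -/
theorem eventually_inner_curl_nsRescale_nonneg {W : ℝ → EuclideanSpace ℝ (Fin 3) → EuclideanSpace ℝ (Fin 3)}
    {e : EuclideanSpace ℝ (Fin 3)} {ρ : ℝ} (hρ : 0 < ρ)
    (hloc : ∀ s : ℝ, -ρ ^ 2 < s → s < 0 → ∀ y : EuclideanSpace ℝ (Fin 3), ‖y‖ < ρ → 0 ≤ ⟪curl (W s) y, e⟫_ℝ)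
    {lam : ℕ → ℝ} (hlam : ∀ k, 0 < lam k) (hlam0 : Tendsto lam atTop (𝓝 0))
    {s : ℝ} (hs : s < 0) (y : EuclideanSpace ℝ (Fin 3)) :
    ∀ᶠ k in atTop, 0 ≤ ⟪curl (nsRescale (lam k) W s) y, e⟫_ℝ := by
  have h1 : Tendsto (fun k => lam k ^ 2 * (-s)) atTop (𝓝 0) := by
    simpa using (hlam0.pow 2).mul_const (-s)
  have h2 : Tendsto (fun k => lam k * ‖y‖) atTop (𝓝 0) := by
    simpa using hlam0.mul_const ‖y‖
  filter_upwards [(tendsto_order.1 h1).2 _ (pow_pos hρ 2), (tendsto_order.1 h2).2 _ hρ] with k hk1 hk2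
  rw [inner_curl_nsRescale]
  refine mul_nonneg (sq_nonneg _) (hloc _ (by linarith) (mul_neg_of_pos_of_neg (pow_pos (hlam k) 2) hs) _ ?_)
  rwa [norm_smul, Real.norm_of_nonneg (hlam k).le]

/-! ### §2 Closedness of the family of apex-zoom limits of `v` -/

/-- **Pointwise limits in `A_C` of apex-zoom limits of `v` are apex-zoom limits of `v`, with gradients.**  If each `W k` is the
pointwise limit on the open slab of the zooms `μₖₙ v(μₖₙ² ·, μₖₙ ·)` (`μₖₙ → 0⁺` as `n → ∞`), and `W k → W₀ ∈ A_C` pointwise, then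
along some `νₙ → 0⁺` the zooms `νₙ v(νₙ² ·, νₙ ·)` converge to `W₀` pointwise on the open slab TOGETHER WITH THEIR GRADIENTS.
(Diagonal choice of `n(k)` against a dense sequence of the open slab; KNSS `C¹_loc` extraction from the chosen zooms; the new
limit agrees with `W₀` on the dense sequence, hence everywhere by continuity.)
[cite: KochNadirashviliSereginSverak2009, Lemma 6.1 and Prop. 4.1 (arXiv:0709.3599 pp. 8, 11)] -/
theorem exists_zoomSeq_of_tendsto {C : ℝ} {v : ℝ → EuclideanSpace ℝ (Fin 3) → EuclideanSpace ℝ (Fin 3)}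
    (hv : IsTypeIAncientMild C v)
    {W : ℕ → ℝ → EuclideanSpace ℝ (Fin 3) → EuclideanSpace ℝ (Fin 3)} {μ : ℕ → ℕ → ℝ} (hμ : ∀ k n, 0 < μ k n)
    (hμ0 : ∀ k, Tendsto (μ k) atTop (𝓝 0))
    (hcv : ∀ k, ∀ t < (0 : ℝ), ∀ x, Tendsto (fun n => nsRescale (μ k n) v t x) atTop (𝓝 (W k t x)))
    {W₀ : ℝ → EuclideanSpace ℝ (Fin 3) → EuclideanSpace ℝ (Fin 3)} (hW₀ : IsTypeIAncientMild C W₀)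
    (hlim : ∀ t < (0 : ℝ), ∀ x, Tendsto (fun k => W k t x) atTop (𝓝 (W₀ t x))) :
    ∃ ν : ℕ → ℝ, (∀ n, 0 < ν n) ∧ Tendsto ν atTop (𝓝 0) ∧
      (∀ t < (0 : ℝ), ∀ x, Tendsto (fun n => nsRescale (ν n) v t x) atTop (𝓝 (W₀ t x))) ∧
      (∀ t < (0 : ℝ), ∀ x, Tendsto (fun n => fderiv ℝ (nsRescale (ν n) v t) x) atTop (𝓝 (fderiv ℝ (W₀ t) x))) := by
  -- a dense sequence of space–time points
  obtain ⟨u, hu⟩ := TopologicalSpace.exists_dense_seq (ℝ × EuclideanSpace ℝ (Fin 3))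
  -- ## diagonal choice of `n(k)`
  have hchoice : ∀ k : ℕ, ∃ n : ℕ, μ k n < 1 / ((k : ℝ) + 1) ∧
      ∀ i ∈ Finset.range (k + 1), (u i).1 < 0 →
        dist (nsRescale (μ k n) v (u i).1 (u i).2) (W k (u i).1 (u i).2) < 1 / ((k : ℝ) + 1) := by
    intro k
    have hk : (0 : ℝ) < 1 / ((k : ℝ) + 1) := by positivity
    have h1 : ∀ᶠ n in atTop, μ k n < 1 / ((k : ℝ) + 1) := (tendsto_order.1 (hμ0 k)).2 _ hk
    have h2 : ∀ᶠ n in atTop, ∀ i ∈ Finset.range (k + 1), (u i).1 < 0 →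
        dist (nsRescale (μ k n) v (u i).1 (u i).2) (W k (u i).1 (u i).2) < 1 / ((k : ℝ) + 1) := by
      refine (eventually_all_finset _).2 fun i _ => ?_
      by_cases hi : (u i).1 < 0
      · have h := (Metric.tendsto_nhds.1 (hcv k _ hi (u i).2)) _ hk
        filter_upwards [h] with n hn _ using hn
      · exact Eventually.of_forall fun n h' => absurd h' hi
    exact (h1.and h2).exists
  choose nk hnk1 hnk2 using hchoice
  set ν₀ : ℕ → ℝ := fun k => μ k (nk k) with hν₀
  have hν₀pos : ∀ k, 0 < ν₀ k := fun k => hμ k (nk k)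
  have hν₀0 : Tendsto ν₀ atTop (𝓝 0) := by
    refine squeeze_zero (fun k => (hν₀pos k).le) (fun k => (hnk1 k).le) ?_
    exact tendsto_one_div_add_atTop_nhds_zero_nat
  -- ## along the dense sequence the chosen zooms converge to `W₀`
  have hdense : ∀ i, (u i).1 < 0 →
      Tendsto (fun k => nsRescale (ν₀ k) v (u i).1 (u i).2) atTop (𝓝 (W₀ (u i).1 (u i).2)) := by
    intro i hi
    rw [tendsto_iff_dist_tendsto_zero]
    have hW : Tendsto (fun k => dist (W k (u i).1 (u i).2) (W₀ (u i).1 (u i).2)) atTop (𝓝 0) :=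
      tendsto_iff_dist_tendsto_zero.1 (hlim _ hi _)
    have hsum : Tendsto (fun k : ℕ => 1 / ((k : ℝ) + 1) + dist (W k (u i).1 (u i).2) (W₀ (u i).1 (u i).2))
        atTop (𝓝 0) := by
      simpa using tendsto_one_div_add_atTop_nhds_zero_nat.add hW
    refine squeeze_zero' (Eventually.of_forall fun k => dist_nonneg) ?_ hsum
    filter_upwards [eventually_ge_atTop i] with k hk
    have hik : i ∈ Finset.range (k + 1) := Finset.mem_range.2 (Nat.lt_succ_of_le hk)
    exact (dist_triangle _ (W k (u i).1 (u i).2) _).trans (add_le_add (hnk2 k i hik hi).le le_rfl)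
  -- ## KNSS re-extraction from the chosen zooms and identification of the limit
  obtain ⟨ψ, hψ, W', hW', hpt, hptD, -, -⟩ := exists_tendsto_of_isTypeIAncientMild_seq C
    (w := fun k => nsRescale (ν₀ k) v) (fun k => isTypeIAncientMild_nsRescale hv (hν₀pos k))
  have hO : IsOpen (Iio (0 : ℝ) ×ˢ (univ : Set (EuclideanSpace ℝ (Fin 3)))) := isOpen_Iio.prod isOpen_univ
  have hEq : EqOn (uncurry W') (uncurry W₀) (Iio (0 : ℝ) ×ˢ (univ : Set (EuclideanSpace ℝ (Fin 3)))) := by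
    refine Set.EqOn.of_subset_closure (s := (Iio (0 : ℝ) ×ˢ univ) ∩ range u) ?_
      hW'.continuousOn_uncurry hW₀.continuousOn_uncurry inter_subset_left (hu.open_subset_closure_inter hO)
    rintro z ⟨hz, i, rfl⟩
    have hi : (u i).1 < 0 := (mem_prod.1 hz).1
    exact tendsto_nhds_unique (hpt _ hi (u i).2) ((hdense i hi).comp hψ.tendsto_atTop)
  have hEq' : ∀ t < (0 : ℝ), W' t = W₀ t := fun t ht =>
    funext fun x => hEq (mk_mem_prod (mem_Iio.2 ht) (mem_univ x))
  refine ⟨fun n => ν₀ (ψ n), fun n => hν₀pos _, hν₀0.comp hψ.tendsto_atTop, fun t ht x => ?_, fun t ht x => ?_⟩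
  · have h := hpt t ht x
    rwa [hEq' t ht] at h
  · have h := hptD t ht x
    rwa [hEq' t ht] at h

/-! ### §3 Zoom-in successors -/

/-- **Zoom-in limits enlarge the sign cone to the local sign cone.**  For `W ∈ X(v)` there is a zoom-in limit `W' ∈ X(v)` (KNSS
extraction from `W(k⁻²·, k⁻¹·)`-type zooms, re-expressed as a limit of zooms of `v` by `exists_zoomSeq_of_tendsto`) such that every
direction one-signed on some apex cylinder of `W` is one-signed on the whole slab for `W'`.
[cite: KochNadirashviliSereginSverak2009, Lemma 6.1 and Prop. 4.1 (arXiv:0709.3599 pp. 8, 11)] -/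
theorem exists_zoomIn_successor {C : ℝ} {v : ℝ → EuclideanSpace ℝ (Fin 3) → EuclideanSpace ℝ (Fin 3)}
    (hv : IsTypeIAncientMild C v) {W : ℝ → EuclideanSpace ℝ (Fin 3) → EuclideanSpace ℝ (Fin 3)}
    (hW : IsTypeIAncientMild C W) {μ : ℕ → ℝ} (hμ : ∀ n, 0 < μ n) (hμ0 : Tendsto μ atTop (𝓝 0))
    (hcv : ∀ t < (0 : ℝ), ∀ x, Tendsto (fun n => nsRescale (μ n) v t x) atTop (𝓝 (W t x))) :
    ∃ W' : ℝ → EuclideanSpace ℝ (Fin 3) → EuclideanSpace ℝ (Fin 3), IsTypeIAncientMild C W' ∧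
      (∃ ν : ℕ → ℝ, (∀ n, 0 < ν n) ∧ Tendsto ν atTop (𝓝 0) ∧
        ∀ t < (0 : ℝ), ∀ x, Tendsto (fun n => nsRescale (ν n) v t x) atTop (𝓝 (W' t x))) ∧
      ∀ e : EuclideanSpace ℝ (Fin 3),
        (∃ ρ : ℝ, 0 < ρ ∧ ∀ s : ℝ, -ρ ^ 2 < s → s < 0 →
            ∀ y : EuclideanSpace ℝ (Fin 3), ‖y‖ < ρ → 0 ≤ ⟪curl (W s) y, e⟫_ℝ) →
          ∀ s < (0 : ℝ), ∀ y : EuclideanSpace ℝ (Fin 3), 0 ≤ ⟪curl (W' s) y, e⟫_ℝ := by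
  -- the zoom scales `ρ k = 1/(k+1)`
  set ρ : ℕ → ℝ := fun k => 1 / ((k : ℝ) + 1) with hρ
  have hρpos : ∀ k, 0 < ρ k := fun k => by positivity
  have hρ0 : Tendsto ρ atTop (𝓝 0) := tendsto_one_div_add_atTop_nhds_zero_nat
  obtain ⟨ψ, hψ, W', hW', hpt, hptD, -, -⟩ := exists_tendsto_of_isTypeIAncientMild_seq C
    (w := fun k => nsRescale (ρ k) W) (fun k => isTypeIAncientMild_nsRescale hW (hρpos k))
  have hρψ0 : Tendsto (fun k => ρ (ψ k)) atTop (𝓝 0) := hρ0.comp hψ.tendsto_atTop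
  refine ⟨W', hW', ?_, fun e he s hs y => ?_⟩
  · -- `W' ∈ X(v)`: the zooms of `W` are limits of zooms of `v`
    have hcv' : ∀ k, ∀ t < (0 : ℝ), ∀ x, Tendsto (fun n => nsRescale (μ n * ρ (ψ k)) v t x) atTop
        (𝓝 (nsRescale (ρ (ψ k)) W t x)) := by
      intro k t ht x
      have hts : ρ (ψ k) ^ 2 * t < 0 := mul_neg_of_pos_of_neg (pow_pos (hρpos _) 2) ht
      have h := (hcv _ hts (ρ (ψ k) • x)).const_smul (ρ (ψ k))
      refine h.congr' (Eventually.of_forall fun n => ?_)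
      show ρ (ψ k) • nsRescale (μ n) v (ρ (ψ k) ^ 2 * t) (ρ (ψ k) • x) = nsRescale (μ n * ρ (ψ k)) v t x
      rw [nsRescale_mul]; rfl
    obtain ⟨ν, hν, hν0, hval, -⟩ := exists_zoomSeq_of_tendsto hv (W := fun k => nsRescale (ρ (ψ k)) W)
      (μ := fun k n => μ n * ρ (ψ k)) (fun k n => mul_pos (hμ n) (hρpos _))
      (fun k => by simpa using hμ0.mul_const (ρ (ψ k))) hcv' hW' hpt
    exact ⟨ν, hν, hν0, hval⟩
  · obtain ⟨r, hr, hloc⟩ := he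
    exact inner_curl_nonneg_of_tendsto (hptD s hs y)
      (eventually_inner_curl_nsRescale_nonneg hr hloc (lam := fun j => ρ (ψ j)) (fun j => hρpos _) hρψ0 hs y)

/-! ### §4 A sign-saturated apex-zoom limit -/

/-- **A SIGN-SATURATED element among the apex-zoom limits of `v`.**  For every profile `v ∈ A_C` there is `W ∈ X(v)` (a pointwise
limit on the open slab of apex zooms `νₙ v(νₙ²·, νₙ·)`, `νₙ → 0⁺`, again in `A_C`) such that (i) every direction one-signed for the
vorticity of `v` on the whole slab is one-signed for `W`, and (ii) `W` is SIGN-SATURATED: every direction one-signed on SOME apex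
cylinder `(−ρ², 0) × B(0, ρ)` of `W` is one-signed on the whole slab.  (The engine `exists_upperBound_stable` on `X(v)` with
`R W W' :⇔ loc-cone W ⊆ cone W'`, successors by `exists_zoomIn_successor`, chain bounds by KNSS extraction + `exists_zoomSeq_of_tendsto`,
and `N W = {i : Bᵢ ∩ cone W ≠ ∅}` for an enumerated countable basis `(Bᵢ)` of `ℝ³`; on the closed cones `N` detects inclusions.)
[cite: KochNadirashviliSereginSverak2009, Lemma 6.1 and Prop. 4.1 (arXiv:0709.3599 pp. 8, 11)] -/
theorem exists_saturated_zoomLimit {C : ℝ} {v : ℝ → EuclideanSpace ℝ (Fin 3) → EuclideanSpace ℝ (Fin 3)}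
    (hv : IsTypeIAncientMild C v) :
    ∃ W : ℝ → EuclideanSpace ℝ (Fin 3) → EuclideanSpace ℝ (Fin 3), IsTypeIAncientMild C W ∧
      (∃ ν : ℕ → ℝ, (∀ n, 0 < ν n) ∧ Tendsto ν atTop (𝓝 0) ∧
        ∀ t < (0 : ℝ), ∀ x, Tendsto (fun n => nsRescale (ν n) v t x) atTop (𝓝 (W t x))) ∧
      (∀ e : EuclideanSpace ℝ (Fin 3), (∀ s < (0 : ℝ), ∀ y : EuclideanSpace ℝ (Fin 3), 0 ≤ ⟪curl (v s) y, e⟫_ℝ) →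
        ∀ s < (0 : ℝ), ∀ y : EuclideanSpace ℝ (Fin 3), 0 ≤ ⟪curl (W s) y, e⟫_ℝ) ∧
      ∀ e : EuclideanSpace ℝ (Fin 3),
        (∃ ρ : ℝ, 0 < ρ ∧ ∀ s : ℝ, -ρ ^ 2 < s → s < 0 →
            ∀ y : EuclideanSpace ℝ (Fin 3), ‖y‖ < ρ → 0 ≤ ⟪curl (W s) y, e⟫_ℝ) →
          ∀ s < (0 : ℝ), ∀ y : EuclideanSpace ℝ (Fin 3), 0 ≤ ⟪curl (W s) y, e⟫_ℝ := by
  classical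
  -- ## the family `X(v)` as a type, its cones, the relation and the index map
  let P : (ℝ → EuclideanSpace ℝ (Fin 3) → EuclideanSpace ℝ (Fin 3)) → Prop := fun W =>
    IsTypeIAncientMild C W ∧ ∃ ν : ℕ → ℝ, (∀ n, 0 < ν n) ∧ Tendsto ν atTop (𝓝 0) ∧
      ∀ t < (0 : ℝ), ∀ x, Tendsto (fun n => nsRescale (ν n) v t x) atTop (𝓝 (W t x))
  let cone : (ℝ → EuclideanSpace ℝ (Fin 3) → EuclideanSpace ℝ (Fin 3)) → Set (EuclideanSpace ℝ (Fin 3)) := fun W =>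
    {e | ∀ s < (0 : ℝ), ∀ y : EuclideanSpace ℝ (Fin 3), 0 ≤ ⟪curl (W s) y, e⟫_ℝ}
  let loc : (ℝ → EuclideanSpace ℝ (Fin 3) → EuclideanSpace ℝ (Fin 3)) → Set (EuclideanSpace ℝ (Fin 3)) := fun W =>
    {e | ∃ ρ : ℝ, 0 < ρ ∧ ∀ s : ℝ, -ρ ^ 2 < s → s < 0 →
      ∀ y : EuclideanSpace ℝ (Fin 3), ‖y‖ < ρ → 0 ≤ ⟪curl (W s) y, e⟫_ℝ}
  have hcl : ∀ W, cone W ⊆ loc W := fun W e he =>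
    ⟨1, one_pos, fun s _ hs y _ => he s hs y⟩
  -- a countable basis of `ℝ³`, enumerated
  obtain ⟨b, hbc, hbe, hb⟩ := TopologicalSpace.exists_countable_basis (EuclideanSpace ℝ (Fin 3))
  have hbne : b.Nonempty := by
    by_contra h
    rw [not_nonempty_iff_eq_empty] at h
    have hu := hb.sUnion_eq
    rw [h, sUnion_empty] at hu
    exact (univ_nonempty (α := EuclideanSpace ℝ (Fin 3))).ne_empty hu.symm
  obtain ⟨B, hB⟩ := hbc.exists_eq_range hbne
  rw [hB] at hb
  let X := {W // P W}
  let R : X → X → Prop := fun a a' => loc a.1 ⊆ cone a'.1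
  let N : X → Set ℕ := fun a => {i | (B i ∩ cone a.1).Nonempty}
  have htrans : ∀ ⦃x y z : X⦄, R x y → R y z → R x z := fun x y z hxy hyz =>
    hxy.trans ((hcl y.1).trans hyz)
  have hmono : ∀ ⦃x y : X⦄, R x y → N x ⊆ N y := fun x y hxy i ⟨z, hzB, hz⟩ =>
    ⟨z, hzB, hxy (hcl x.1 hz)⟩
  have hsucc : ∀ x : X, ∃ y : X, R x y := by
    rintro ⟨W, hW, μ, hμ, hμ0, hcvW⟩
    obtain ⟨W', hW', hmem, hsign⟩ := exists_zoomIn_successor hv hW hμ hμ0 hcvW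
    exact ⟨⟨W', hW', hmem⟩, fun e he => hsign e he⟩
  -- ## chains have upper bounds: KNSS limit of the chain, re-expressed as a zoom limit of `v`
  have hchain : ∀ x : ℕ → X, (∀ n, R (x n) (x (n + 1))) → ∃ W : X, ∀ n, R (x n) W := by
    intro x hx
    obtain ⟨ψ, hψ, W₀, hW₀, hpt, hptD, -, -⟩ := exists_tendsto_of_isTypeIAncientMild_seq C
      (w := fun k => (x k).1) (fun k => (x k).2.1)
    -- the scales of the members of the chain
    choose μ hμ hμ0 hcvμ using fun k => (x (ψ k)).2.2
    obtain ⟨ν, hν, hν0, hval, -⟩ := exists_zoomSeq_of_tendsto hv (W := fun k => (x (ψ k)).1) hμ hμ0 hcvμ hW₀ hpt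
    -- the cones increase along the chain and pass to the limit
    have hstep : ∀ m, cone (x m).1 ⊆ cone (x (m + 1)).1 := fun m => (hcl _).trans (hx m)
    have hup : ∀ m m', m ≤ m' → cone (x m).1 ⊆ cone (x m').1 := by
      intro m m' hmm'
      induction hmm' with
      | refl => exact Subset.rfl
      | step _ ih => exact ih.trans (hstep _)
    have hlimcone : ∀ m, cone (x m).1 ⊆ cone W₀ := by
      intro m e he s hs y
      refine inner_curl_nonneg_of_tendsto (hptD s hs y) ?_
      filter_upwards [eventually_ge_atTop m] with k hk
      exact hup m (ψ k) (hk.trans (hψ.id_le k)) he s hs y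
    exact ⟨⟨W₀, hW₀, ν, hν, hν0, hval⟩, fun n => (hx n).trans (hlimcone (n + 1))⟩
  -- ## the base point: the KNSS limit of the zooms `v(k⁻²·, k⁻¹·)`, whose cone contains that of `v`
  set ρ : ℕ → ℝ := fun k => 1 / ((k : ℝ) + 1) with hρ
  have hρpos : ∀ k, 0 < ρ k := fun k => by positivity
  have hρ0 : Tendsto ρ atTop (𝓝 0) := tendsto_one_div_add_atTop_nhds_zero_nat
  obtain ⟨ψ₀, hψ₀, W₁, hW₁, hpt₁, hptD₁, -, -⟩ := exists_tendsto_of_isTypeIAncientMild_seq C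
    (w := fun k => nsRescale (ρ k) v) (fun k => isTypeIAncientMild_nsRescale hv (hρpos k))
  have hP₁ : P W₁ := ⟨hW₁, fun n => ρ (ψ₀ n), fun n => hρpos _, hρ0.comp hψ₀.tendsto_atTop, hpt₁⟩
  have hcone₁ : cone v ⊆ cone W₁ := by
    intro e he s hs y
    refine inner_curl_nonneg_of_tendsto (hptD₁ s hs y) (Eventually.of_forall fun k => ?_)
    show 0 ≤ ⟪curl (nsRescale (ρ (ψ₀ k)) v s) y, e⟫_ℝ
    rw [inner_curl_nsRescale]
    exact mul_nonneg (sq_nonneg _) (he _ (mul_neg_of_pos_of_neg (pow_pos (hρpos _) 2) hs) _)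
  -- ## the engine
  obtain ⟨W, hRW, hstable⟩ := exists_upperBound_stable R N htrans hsucc hchain hmono ⟨W₁, hP₁⟩
  obtain ⟨W', hRW'⟩ := hsucc W
  -- `cone W' = cone W`: `N` detects inclusions of closed cones
  have hWW' : cone W'.1 ⊆ cone W.1 :=
    subset_of_isClosed_of_basis hb (isClosed_signCone W.1) fun i hi => hstable W' hRW' hi
  refine ⟨W.1, W.2.1, W.2.2, fun e he => ?_, fun e he => hWW' (hRW' he)⟩
  exact hRW ((hcl W₁) (hcone₁ he))

end Summit.NavierStokesRegularity.NavierStokesRegularity.Theorems.AxisTwistDoorSignConeZoomFamily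

end
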